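import Literature.AlgebraicGeometry.Frobenioids.PerfFactorialPrimes
import Literature.AlgebraicGeometry.Frobenioids.PreFrobenioidMorphisms
import Literature.AlgebraicGeometry.Frobenioids.ElementaryPreFrobenioid
import HarnessLib

/-!
# [FrdI] Theorem 4.2 (i), Div-identity endomorphisms: the non-dilation half («α is a Div-identity
# endomorphism iff `Base(α)^*` maps every prime of `Φ(A_D)` into itself») — S5 row T42-L11, part (a)

Mochizuki, *The geometry of Frobenioids I: the general theory*, Kyushu J. Math. **62** (2008)
293–400, §4, Theorem 4.2 (i), proof p. 81 ll. 5–8 (render `paper:url-bbf705efa10f`, read on the page)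
[cite: MochizukiFrdI2008, Thm. 4.2 (i) p.81]:

> "Next, we observe that `Ψ` preserves Div-identity endomorphisms. Indeed, since the `Φ_i` are
> non-dilating, it follows that if `A ∈ Ob(C_i)` [where `i = 1, 2`], then `α ∈ End_{C_i}(A)` is a
> Div-identity endomorphism if and only if `α` admits a factorization …" [the rest of the sentence is
> the category-theoretic description of «`Base(α)^*` fixes every prime of `Φ_i(A)`» via primary
> steps and `Prime(Φ_i(γ))`].

PROOF-ONLY helper for sub-DAG `plan/L1/SUBDAG-FrdI-Thm42-Thm49.md`, row `FrdI:Thm4.2(i)/T42-L11`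
(`FrdI.T42.PreservesDivIdentity`, `Thm42SubII.lean`, seat abc-iut-L1-t14): the MONOID HALF of the
printed equivalence, i.e. exactly what "since the `Φ_i` are non-dilating" supplies. For a pre-Frobenioid
`C → F_Φ` with `Φ` non-dilating (Def. 1.1 (ii)) and an endomorphism `α` of `A`:
`α` is a Div-identity endomorphism (`Base(α)^* = id` on `Φ(A_D)`) iff `Base(α)^*` maps every prime
`𝔭 ⊆ Φ(A_D)` into its submonoid `Φ(A_D)_𝔭 = 𝔭 ∪ {0}` (`PreFrobenioid.isDivIdentity_iff_forall_primes`);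
equivalently iff `Base(α)^* x ≼ x` for every PRIMARY `x` (`isDivIdentity_of_precsim_of_isPrimary`, the
primary-only sharpening of `PreFrobenioid.pull_eq_id_of_precsim` of `IrreducibleMorphismsDivIdentity.lean`).
Monoid ingredients: `≼` and primarity are transported along `M → M^char = Associates M` (any commutative
monoid, resp. sharp ones: `precsim_associatesMk_iff`, `isPrimary_associatesMk_iff`; injectivity of
`Associates.mk` for sharp monoids is the tree's `associatesMk_injective_of_isSharp`), and two elements of
`Φ(A_D)_𝔭` with the second in `𝔭` are `≼`-comparable (`Primes.precsim_of_mem_submonoid`, tree). The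
category-theoretic half of row L11 (primary steps, `Prime(Φ(γ))`, Prop. 1.11 (v)) is NOT in this file.
Multiplicative notation (`0 ↦ 1`). No new definitions; nothing of the paper is asserted beyond what is
proved.
-/

namespace Literature.AlgebraicGeometry.Frobenioids

open CategoryTheory Opposite Function

universe u

/-! ### `≼` and primary elements along `M → M^char` -/

section Monoid

variable {M : Type u} [CommMonoid M]

/-- `≼` is detected in `M^char = Associates M` (divisibility of classes is divisibility of
representatives). [cite: MochizukiFrdI2008, §0 p.11] -/
theorem precsim_associatesMk_iff {a b : M} : Associates.mk a ≼ Associates.mk b ↔ a ≼ b := by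
  constructor
  · rintro ⟨n, hn, h⟩
    exact ⟨n, hn, by rwa [← Associates.mk_pow, Associates.mk_dvd_mk] at h⟩
  · rintro ⟨n, hn, h⟩
    exact ⟨n, hn, by rw [← Associates.mk_pow, Associates.mk_dvd_mk]; exact h⟩

/-- In a sharp monoid `mk a = 1 ↔ a = 1`. [cite: MochizukiFrdI2008, §0 p.11] -/
theorem associatesMk_eq_one_iff_of_isSharp (hM : IsSharp M) {a : M} : Associates.mk a = 1 ↔ a = 1 :=
  ⟨fun h => hM.eq_one_of_isUnit _ (Associates.mk_eq_one.mp h), fun h => by rw [h, Associates.mk_one]⟩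

/-- In a sharp monoid (`M^char = M`) an element is primary iff its class in `M^char` is.
[cite: MochizukiFrdI2008, §0 p.12] -/
theorem isPrimary_associatesMk_iff (hM : IsSharp M) {a : M} :
    IsPrimary (Associates.mk a) ↔ IsPrimary a := by
  constructor
  · rintro ⟨h1, h2⟩
    refine ⟨fun ha => h1 ((associatesMk_eq_one_iff_of_isSharp hM).mpr ha), fun b hb hba => ?_⟩
    exact precsim_associatesMk_iff.mp
      (h2 (Associates.mk b) (fun hb1 => hb ((associatesMk_eq_one_iff_of_isSharp hM).mp hb1))
        (precsim_associatesMk_iff.mpr hba))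
  · rintro ⟨h1, h2⟩
    refine ⟨fun ha => h1 ((associatesMk_eq_one_iff_of_isSharp hM).mp ha), fun b hb hba => ?_⟩
    obtain ⟨b, rfl⟩ := Associates.mk_surjective b
    exact precsim_associatesMk_iff.mpr
      (h2 b (fun hb' => hb ((associatesMk_eq_one_iff_of_isSharp hM).mpr hb')) (precsim_associatesMk_iff.mp hba))

/-- A primary element lies in the subset `𝔭 ⊆ M` of its own prime. [cite: MochizukiFrdI2008, §0 p.12] -/
theorem mem_carrier_primesMk {a : M} (ha : IsPrimary a) :
    a ∈ Primes.carrier (M := M) (Quotient.mk (primarySetoid M) ⟨a, ha⟩) :=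
  ⟨ha, rfl⟩

end Monoid

/-! ### Div-identity endomorphisms over a non-dilating divisor monoid -/

namespace PreFrobenioid

universe w v v' u'

variable {D : Type u'} [Category.{v} D] {Φ : Dᵒᵖ ⥤ CommMonCat.{w}}
  {C : Type u} [Category.{v'} C] {F : C ⥤ ElemFrobenioid Φ}

/-- **Non-dilation, primary form** (Def. 1.1 (i)/(ii)): if `f^*(x) ≼ x` for every PRIMARY
`x ∈ Φ(A_D)` then `f^* = id` on `Φ(A_D)` (`Φ(A_D)` divisorial, hence sharp, so `Φ(A_D)^char = Φ(A_D)`)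
— the hypothesis of `pull_eq_id_of_precsim` restricted to primary elements, which is what Def. 1.1 (i)
asks. [cite: MochizukiFrdI2008, Def. 1.1 (i) p.19] -/
theorem pull_eq_id_of_precsim_of_isPrimary (hP : IsPreFrobenioid Φ F) (hnd : IsNonDilatingOn Φ) {A : C}
    (f : baseObj F A ⟶ baseObj F A) (h : ∀ x, IsPrimary x → pull Φ f x ≼ x) :
    pull Φ f = MonoidHom.id _ := by
  have hsharp : IsSharp (Φ.obj (op (baseObj F A))) := (hP.isDivisorial (baseObj F A)).isSharp
  have hchar := hnd (baseObj F A) f (fun a ha => by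
    obtain ⟨x, rfl⟩ := Associates.mk_surjective a
    rw [associatesMap_mk]
    exact (h x ((isPrimary_associatesMk_iff hsharp).mp ha)).map Associates.mkMonoidHom)
  ext x
  have h1 := congrArg (fun g => g (Associates.mk x)) hchar
  simp only [associatesMap_mk, MonoidHom.id_apply] at h1
  exact associatesMk_injective_of_isSharp hsharp h1

/-- **Div-identity from `≼` on primaries**: if `Base(α)^*(x) ≼ x` for every primary `x ∈ Φ(A_D)` then
`α` is a Div-identity endomorphism (`Φ` non-dilating). [cite: MochizukiFrdI2008, Thm. 4.2 (i) p.81] -/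
theorem isDivIdentity_of_precsim_of_isPrimary (hP : IsPreFrobenioid Φ F) (hnd : IsNonDilatingOn Φ)
    {A : C} (α : A ⟶ A) (h : ∀ x, IsPrimary x → pull Φ (Base F α) x ≼ x) : IsDivIdentity F α :=
  pull_eq_id_of_precsim_of_isPrimary hP hnd (Base F α) h

/-- **The non-dilation half of [FrdI] Thm. 4.2 (i), Div-identity clause** (p. 81 ll. 5–8, "since the
`Φ_i` are non-dilating … `α` is a Div-identity endomorphism if and only if …"): over a non-dilating
divisor monoid, `α ∈ End(A)` is a Div-identity endomorphism iff `Base(α)^*` maps every prime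
`𝔭 ⊆ Φ(A_D)` into the submonoid `Φ(A_D)_𝔭 = 𝔭 ∪ {0}` it generates (i.e. fixes every prime of `Φ(A_D)`
as a ray). [cite: MochizukiFrdI2008, Thm. 4.2 (i) p.81] -/
theorem isDivIdentity_iff_forall_primes (hP : IsPreFrobenioid Φ F) (hnd : IsNonDilatingOn Φ) {A : C}
    (α : A ⟶ A) :
    IsDivIdentity F α ↔ ∀ (𝔭 : Primes (Φ.obj (op (baseObj F A)))) (x : Φ.obj (op (baseObj F A))),
      x ∈ 𝔭.carrier → pull Φ (Base F α) x ∈ 𝔭.submonoid := by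
  constructor
  · intro hα 𝔭 x hx
    have hx' : pull Φ (Base F α) x = x := by
      rw [show pull Φ (Base F α) = MonoidHom.id _ from hα, MonoidHom.id_apply]
    rw [hx']
    exact Submonoid.subset_closure hx
  · intro h
    refine isDivIdentity_of_precsim_of_isPrimary hP hnd α fun x hx => ?_
    exact Primes.precsim_of_mem_submonoid _ (mem_carrier_primesMk hx) (h _ x (mem_carrier_primesMk hx))

/-- Variant: it suffices that `Base(α)^*` maps every prime `𝔭` into ITSELF (primary to primary of the
same class). [cite: MochizukiFrdI2008, Thm. 4.2 (i) p.81] -/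
theorem isDivIdentity_of_mapsTo_primes (hP : IsPreFrobenioid Φ F) (hnd : IsNonDilatingOn Φ) {A : C}
    (α : A ⟶ A)
    (h : ∀ (𝔭 : Primes (Φ.obj (op (baseObj F A)))), Set.MapsTo (pull Φ (Base F α)) 𝔭.carrier 𝔭.carrier) :
    IsDivIdentity F α :=
  (isDivIdentity_iff_forall_primes hP hnd α).mpr fun 𝔭 _ hx => Submonoid.subset_closure (h 𝔭 hx)

end PreFrobenioid

end Literature.AlgebraicGeometry.Frobenioids
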